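import Mathlib
import Summits.KontsevichZagierPeriods.KontsevichZagierPeriods.Theorems.SoloInformedZetaTwoTwoStep
import HarnessLib
import HarnessLib.Audit

/-!
# SoloInformed — the `(2,2)` telescope: garland side

Solo programme `solo-KontsevichZagierPeriods-informed`, session s45 (PART XVI). The left side
`R₁ = [(0,1)⁴ ∩ {x₂x₃ < x₀}, 1/((1 − x₀x₁)(1 − x₂x₃))]` of the `(2,2)` step is carried by the block
charts `λ'(x) = (x₀, x₀x₁, x₂, x₂x₃)` (rule (2), Jacobian `x₀x₂`) onto the GARLAND representation
`G' = [𝒢', 1/(t₀(1−t₁)t₂(1−t₃))]`, `𝒢' = (0,1)⁴ ∩ {t₁ < t₀} ∩ {t₃ < t₂} ∩ {t₃ < t₀}` (Yamamoto's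
integral for `ζ⋆(2,2)`), and `𝒢'` is dissected (rule (1a), walls `{t₀=t₂} ∪ {t₁=t₂} ∪ {t₁=t₃}` null)
into the FIVE linear extensions of the zigzag poset `t₀ > t₁, t₂ > t₃, t₀ > t₃`:
`t₀>t₁>t₂>t₃` (word `0101 = ζ(2,2)`) and `t₀>t₂>t₁>t₃`, `t₀>t₂>t₃>t₁`, `t₂>t₀>t₁>t₃`, `t₂>t₀>t₃>t₁`
(word `0011 = ζ(3,1)` each). Main results: `soloInformed_t22_moveA`, `soloInformed_t22_moveB`.
-/

noncomputable section

open MeasureTheory Set MvPolynomial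
open Literature.ModelTheory.ExponentialFields Literature.NumberTheory.Transcendental
open Literature.NumberTheory.Transcendental.KZ

namespace Summit.KontsevichZagierPeriods.KontsevichZagierPeriods.Theorems

/-! ## 1. Chain domains `(0,1)⁴ ∩ {t_a > t_b > t_c > t_d}` -/

/-- The chain domain `𝒞(a,b,c,d) = (0,1)⁴ ∩ {t_b < t_a} ∩ {t_c < t_b} ∩ {t_d < t_c}`. -/
def soloInformedCh4 (a b c d : Fin 4) : Set (Fin 4 → ℝ) :=
  soloInformedOpenCube 4 ∩ ({t | t b < t a} ∩ {t | t c < t b} ∩ {t | t d < t c})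

/-- Membership in a chain domain. -/
theorem soloInformed_mem_ch4 {a b c d : Fin 4} {t : Fin 4 → ℝ} : t ∈ soloInformedCh4 a b c d ↔
    t ∈ soloInformedOpenCube 4 ∧ t b < t a ∧ t c < t b ∧ t d < t c := by
  simp only [soloInformedCh4, mem_inter_iff, mem_setOf_eq, and_assoc]

/-- Chain domains are `ℚ`-semialgebraic. -/
theorem isSemialgebraic_soloInformedCh4 (a b c d : Fin 4) : IsSemialgebraic ℚ (soloInformedCh4 a b c d) :=
  (isSemialgebraic_soloInformedOpenCube 4).inter
    (soloInformed_isSemialgebraic_coordLt3 b a c b d c)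

/-- `𝒞(0,1,2,3) = ∇⁴ = KZ.openOrderedSimplex 4`. -/
theorem soloInformed_ch4_0123 : soloInformedCh4 0 1 2 3 = openOrderedSimplex 4 := by
  rw [soloInformed_openOrderedSimplex4_eq]; rfl

/-! ## 2. The garland domain `𝒢'` and the integrand `1/(t₀(1−t₁)t₂(1−t₃))` -/

/-- The integrand `g'(t) = 1/(t₀ (1 − t₁) t₂ (1 − t₃))`. -/
def soloInformedT22g (t : Fin 4 → ℝ) : ℝ := 1 / (t 0 * (1 - t 1) * t 2 * (1 - t 3))

/-- Its denominator is positive on the open cube. -/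
theorem soloInformedT22g_den_pos {t : Fin 4 → ℝ} (ht : t ∈ soloInformedOpenCube 4) :
    0 < t 0 * (1 - t 1) * t 2 * (1 - t 3) :=
  mul_pos (mul_pos (mul_pos (ht 0).1 (by linarith [(ht 1).2])) (ht 2).1) (by linarith [(ht 3).2])

/-- The garland domain `𝒢' = (0,1)⁴ ∩ {t₁ < t₀} ∩ {t₃ < t₂} ∩ {t₃ < t₀}`. -/
def soloInformedT22G : Set (Fin 4 → ℝ) :=
  soloInformedOpenCube 4 ∩ ({t | t 1 < t 0} ∩ {t | t 3 < t 2} ∩ {t | t 3 < t 0})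

/-- Membership in `𝒢'`. -/
theorem soloInformed_mem_T22G {t : Fin 4 → ℝ} : t ∈ soloInformedT22G ↔
    t ∈ soloInformedOpenCube 4 ∧ t 1 < t 0 ∧ t 3 < t 2 ∧ t 3 < t 0 := by
  simp only [soloInformedT22G, mem_inter_iff, mem_setOf_eq, and_assoc]

/-- `𝒢'` is `ℚ`-semialgebraic. -/
theorem isSemialgebraic_soloInformedT22G : IsSemialgebraic ℚ soloInformedT22G :=
  (isSemialgebraic_soloInformedOpenCube 4).inter
    (soloInformed_isSemialgebraic_coordLt3 1 0 3 2 3 0)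

/-! ## 3. The block charts `λ'(x) = (x₀, x₀x₁, x₂, x₂x₃)` -/

/-- The polynomial components of `λ'`. -/
def soloInformedLam2Poly : Fin 4 → MvPolynomial (Fin 4) ℚ := ![X 0, X 0 * X 1, X 2, X 2 * X 3]

/-- `λ'`. -/
def soloInformedLam2 : (Fin 4 → ℝ) → Fin 4 → ℝ := soloInformedPolyMap soloInformedLam2Poly

/-- Auxiliary ((2,2) garland): `soloInformedLam2_zero`. -/
@[simp] theorem soloInformedLam2_zero (x : Fin 4 → ℝ) : soloInformedLam2 x 0 = x 0 := by
  simp [soloInformedLam2, soloInformedLam2Poly, soloInformedPolyMap]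
/-- Auxiliary ((2,2) garland): `soloInformedLam2_one`. -/
@[simp] theorem soloInformedLam2_one (x : Fin 4 → ℝ) : soloInformedLam2 x 1 = x 0 * x 1 := by
  simp [soloInformedLam2, soloInformedLam2Poly, soloInformedPolyMap]
/-- Auxiliary ((2,2) garland): `soloInformedLam2_two`. -/
@[simp] theorem soloInformedLam2_two (x : Fin 4 → ℝ) : soloInformedLam2 x 2 = x 2 := by
  simp [soloInformedLam2, soloInformedLam2Poly, soloInformedPolyMap]
/-- Auxiliary ((2,2) garland): `soloInformedLam2_three`. -/
@[simp] theorem soloInformedLam2_three (x : Fin 4 → ℝ) : soloInformedLam2 x 3 = x 2 * x 3 := by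
  simp [soloInformedLam2, soloInformedLam2Poly, soloInformedPolyMap]

/-- **`det J_{λ'}(x) = x₀x₂`** (block-triangular Jacobian). -/
theorem soloInformed_det_lam2 (x : Fin 4 → ℝ) :
    (soloInformedJacCLM soloInformedLam2Poly x).det = x 0 * x 2 := by
  rw [soloInformed_det_jacCLM]
  simp [Matrix.det_succ_row_zero, Fin.sum_univ_succ, soloInformedLam2Poly, pderiv_X,
    Derivation.leibniz, Pi.single_apply, Fin.succAbove]

/-- `λ'` is injective on the open cube. -/
theorem soloInformed_injOn_lam2 : InjOn soloInformedLam2 (soloInformedOpenCube 4) := by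
  intro x hx x' hx' h
  have h0 : x 0 = x' 0 := by simpa using congr_fun h 0
  have h1' : x 0 * x 1 = x' 0 * x' 1 := by simpa using congr_fun h 1
  have h2 : x 2 = x' 2 := by simpa using congr_fun h 2
  have h3' : x 2 * x 3 = x' 2 * x' 3 := by simpa using congr_fun h 3
  have h1 : x 1 = x' 1 := by
    rw [← h0] at h1'; exact mul_left_cancel₀ (hx 0).1.ne' h1'
  have h3 : x 3 = x' 3 := by
    rw [← h2] at h3'; exact mul_left_cancel₀ (hx 2).1.ne' h3'
  ext j; fin_cases j
  · exact h0
  · exact h1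
  · exact h2
  · exact h3

/-- **`λ'((0,1)⁴ ∩ {x₂x₃ < x₀}) = 𝒢'`.** -/
theorem soloInformed_image_lam2 :
    soloInformedLam2 '' (soloInformedOpenCube 4 ∩ {x | x 2 * x 3 < x 0}) = soloInformedT22G := by
  refine Subset.antisymm ?_ fun t ht => ?_
  · rintro _ ⟨x, ⟨hx, h230⟩, rfl⟩
    have h0 := hx 0; have h1 := hx 1; have h2 := hx 2; have h3 := hx 3
    have h230' : x 2 * x 3 < x 0 := h230
    have h01 := mul_pos h0.1 h1.1
    have h23 := mul_pos h2.1 h3.1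
    refine soloInformed_mem_T22G.2 ⟨fun j => ?_, ?_, ?_, ?_⟩
    · fin_cases j
      · simpa using h0
      · show 0 < soloInformedLam2 x 1 ∧ soloInformedLam2 x 1 < 1
        rw [soloInformedLam2_one]; exact ⟨h01, by nlinarith⟩
      · simpa using h2
      · show 0 < soloInformedLam2 x 3 ∧ soloInformedLam2 x 3 < 1
        rw [soloInformedLam2_three]; exact ⟨h23, by nlinarith⟩
    · rw [soloInformedLam2_one, soloInformedLam2_zero]; nlinarith
    · rw [soloInformedLam2_three, soloInformedLam2_two]; nlinarith
    · rw [soloInformedLam2_three, soloInformedLam2_zero]; exact h230'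
  · obtain ⟨hc, h10, h32, h30⟩ := soloInformed_mem_T22G.1 ht
    have h0 := hc 0; have h1 := hc 1; have h2 := hc 2; have h3 := hc 3
    refine ⟨![t 0, t 1 / t 0, t 2, t 3 / t 2], ⟨fun j => ?_, ?_⟩, ?_⟩
    · fin_cases j
      · simpa using h0
      · simpa using And.intro (div_pos h1.1 h0.1) ((div_lt_one h0.1).2 h10)
      · simpa using h2
      · simpa using And.intro (div_pos h3.1 h2.1) ((div_lt_one h2.1).2 h32)
    · show Matrix.vecCons (t 0) ![t 1 / t 0, t 2, t 3 / t 2] 2 *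
        Matrix.vecCons (t 0) ![t 1 / t 0, t 2, t 3 / t 2] 3 <
        Matrix.vecCons (t 0) ![t 1 / t 0, t 2, t 3 / t 2] 0
      simpa [mul_div_cancel₀ _ h2.1.ne'] using h30
    · ext j; fin_cases j
      · simp
      · simp [mul_div_cancel₀ _ h0.1.ne']
      · simp
      · simp [mul_div_cancel₀ _ h2.1.ne']

/-! ## 4. The garland representation `G'` and the move `R₁ ≡ G'` -/

/-- The pull-back identity `R₁(x) = g'(λ' x) · |det J_{λ'}(x)|` on the cube. -/
theorem soloInformedT22g_lam2 {x : Fin 4 → ℝ} (hx : x ∈ soloInformedOpenCube 4) :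
    1 / ((1 - x 1 * x 0) * (1 - x 2 * x 3)) =
      soloInformedT22g (soloInformedLam2 x) * |(soloInformedJacCLM soloInformedLam2Poly x).det| := by
  have h0 := hx 0; have h2 := hx 2
  rw [soloInformed_det_lam2, abs_of_pos (mul_pos h0.1 h2.1), soloInformedT22g]
  simp only [soloInformedLam2_zero, soloInformedLam2_one, soloInformedLam2_two, soloInformedLam2_three]
  have ha : x 0 ≠ 0 := h0.1.ne'
  have hb : x 2 ≠ 0 := h2.1.ne'
  have hc : (1 - x 1 * x 0) ≠ 0 := (soloInformed_T22_pos1 hx).ne'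
  have hd : (1 - x 2 * x 3) ≠ 0 := (soloInformed_T22_pos2 hx).ne'
  rw [show (1 - x 0 * x 1) = (1 - x 1 * x 0) by ring]
  field_simp

/-- Integrability of `g'` on `𝒢'` (transport of `R₁` along `λ'`). -/
theorem soloInformed_integrableOn_T22g : IntegrableOn soloInformedT22g soloInformedT22G := by
  rw [← soloInformed_image_lam2, soloInformedLam2, soloInformed_integrableOn_image_polyMap_iff _
    soloInformed_measurableSet_T22D1 (soloInformed_injOn_lam2.mono inter_subset_left)]
  have h := soloInformedT22Datum.R1.integrableOn
  rw [soloInformedT22_R1_domain] at h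
  refine h.congr_fun (fun x hx => ?_) soloInformed_measurableSet_T22D1
  rw [soloInformedT22_R1_integrand, soloInformedT22g_lam2 hx.1, mul_comm]
  rfl

/-- **The garland representation `G' = [𝒢', 1/(t₀(1−t₁)t₂(1−t₃))]`.** -/
def soloInformedT22GRep : IntegralRep 4 where
  domain := soloInformedT22G
  integrand := soloInformedT22g
  isSemialgebraic_domain := isSemialgebraic_soloInformedT22G
  isSemialgebraicFunOn_integrand :=
    soloInformed_isSemialgebraicFunOn_quot isSemialgebraic_soloInformedT22G 1
      (X 0 * (1 - X 1) * X 2 * (1 - X 3)) _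
      (fun t ht => by simpa using (soloInformedT22g_den_pos ht.1).ne')
      fun t _ => by simp [soloInformedT22g]
  integrableOn := soloInformed_integrableOn_T22g

/-- **Move A (rule (2) along `λ'`)**: `[R₁] − [G'] ∈ relations`. -/
theorem soloInformed_t22_moveA : of soloInformedT22Datum.R1 - of soloInformedT22GRep ∈ relations := by
  refine soloInformed_of_sub_of_mem_relations_polyMapCLM soloInformedLam2Poly soloInformedT22Datum.R1
    soloInformedT22GRep ?_ ?_ fun x hx => ?_
  · rw [soloInformedT22_R1_domain]; exact soloInformed_injOn_lam2.mono inter_subset_left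
  · rw [soloInformedT22_R1_domain]; exact soloInformed_image_lam2.symm
  · rw [soloInformedT22_R1_domain] at hx
    rw [soloInformedT22_R1_integrand]
    exact soloInformedT22g_lam2 hx.1

/-! ## 5. The dissection of `𝒢'` into the five linear extensions -/

/-- The five chains `t₀>t₁>t₂>t₃`, `t₀>t₂>t₁>t₃`, `t₀>t₂>t₃>t₁`, `t₂>t₀>t₁>t₃`, `t₂>t₀>t₃>t₁` lie in `𝒢'`. -/
theorem soloInformed_ch4_subset_T22G :
    soloInformedCh4 0 1 2 3 ⊆ soloInformedT22G ∧ soloInformedCh4 0 2 1 3 ⊆ soloInformedT22G ∧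
    soloInformedCh4 0 2 3 1 ⊆ soloInformedT22G ∧ soloInformedCh4 2 0 1 3 ⊆ soloInformedT22G ∧
    soloInformedCh4 2 0 3 1 ⊆ soloInformedT22G := by
  refine ⟨fun t ht => ?_, fun t ht => ?_, fun t ht => ?_, fun t ht => ?_, fun t ht => ?_⟩ <;>
  · obtain ⟨hc, h1, h2, h3⟩ := soloInformed_mem_ch4.1 ht
    exact soloInformed_mem_T22G.2 ⟨hc, by linarith, by linarith, by linarith⟩

/-- `P₀ = G'|_{t₀>t₁>t₂>t₃}`. -/
def soloInformedT22P0 : IntegralRep 4 := soloInformedT22GRep.restrict (soloInformedCh4 0 1 2 3)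
  (isSemialgebraic_soloInformedCh4 0 1 2 3) soloInformed_ch4_subset_T22G.1
/-- `P₁ = G'|_{t₀>t₂>t₁>t₃}`. -/
def soloInformedT22P1 : IntegralRep 4 := soloInformedT22GRep.restrict (soloInformedCh4 0 2 1 3)
  (isSemialgebraic_soloInformedCh4 0 2 1 3) soloInformed_ch4_subset_T22G.2.1
/-- `P₂ = G'|_{t₀>t₂>t₃>t₁}`. -/
def soloInformedT22P2 : IntegralRep 4 := soloInformedT22GRep.restrict (soloInformedCh4 0 2 3 1)
  (isSemialgebraic_soloInformedCh4 0 2 3 1) soloInformed_ch4_subset_T22G.2.2.1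
/-- `P₃ = G'|_{t₂>t₀>t₁>t₃}`. -/
def soloInformedT22P3 : IntegralRep 4 := soloInformedT22GRep.restrict (soloInformedCh4 2 0 1 3)
  (isSemialgebraic_soloInformedCh4 2 0 1 3) soloInformed_ch4_subset_T22G.2.2.2.1
/-- `P₄ = G'|_{t₂>t₀>t₃>t₁}`. -/
def soloInformedT22P4 : IntegralRep 4 := soloInformedT22GRep.restrict (soloInformedCh4 2 0 3 1)
  (isSemialgebraic_soloInformedCh4 2 0 3 1) soloInformed_ch4_subset_T22G.2.2.2.2

/-- The five pieces. -/
def soloInformedT22Pieces : Fin 5 → IntegralRep 4 :=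
  ![soloInformedT22P0, soloInformedT22P1, soloInformedT22P2, soloInformedT22P3, soloInformedT22P4]

/-- The wall polynomial `(X₀ − X₂)(X₁ − X₂)(X₁ − X₃) ≠ 0`. -/
theorem soloInformed_t22Wall_ne :
    ((X 0 - X 2) * (X 1 - X 2) * (X 1 - X 3) : MvPolynomial (Fin 4) ℚ) ≠ 0 := by
  intro h
  have := congr_arg (fun p : MvPolynomial (Fin 4) ℚ => aeval (![1, 2, 0, 0] : Fin 4 → ℚ) p) h
  simp at this

/-- The walls `𝒢' \ ⋃ pieces ⊆ {t₀=t₂} ∪ {t₁=t₂} ∪ {t₁=t₃}` are null. -/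
theorem soloInformed_t22Wall_null :
    volume (soloInformedT22G \ ⋃ j ∈ (Finset.univ : Finset (Fin 5)),
      (soloInformedT22Pieces j).domain) = 0 := by
  refine soloInformed_volume_eq_zero_of_subset_zeroSet _ soloInformed_t22Wall_ne fun t ht => ?_
  obtain ⟨hc, h10, h32, h30⟩ := soloInformed_mem_T22G.1 ht.1
  have hnot := ht.2
  simp only [Finset.mem_univ, iUnion_true, mem_iUnion, not_exists] at hnot
  have e0 : t ∉ soloInformedCh4 0 1 2 3 := hnot 0
  have e1 : t ∉ soloInformedCh4 0 2 1 3 := hnot 1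
  have e2 : t ∉ soloInformedCh4 0 2 3 1 := hnot 2
  have e3 : t ∉ soloInformedCh4 2 0 1 3 := hnot 3
  have e4 : t ∉ soloInformedCh4 2 0 3 1 := hnot 4
  simp only [soloInformed_mem_ch4, not_and, not_lt] at e0 e1 e2 e3 e4
  simp only [map_mul, map_sub, aeval_X, mul_eq_zero, sub_eq_zero]
  rcases lt_trichotomy (t 1) (t 2) with h12 | h12 | h21
  · rcases lt_trichotomy (t 0) (t 2) with h02 | h02 | h20
    · exact Or.inr (le_antisymm (e3 hc h02 h10) (e4 hc h02 h30))
    · exact Or.inl (Or.inl h02)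
    · exact Or.inr (le_antisymm (e1 hc h20 h12) (e2 hc h20 h32))
  · exact Or.inl (Or.inr h12)
  · exact absurd h32 (not_lt.2 (e0 hc h10 h21))

/-- **Move B (rule (1a))**: `[G'] − Σ_{k<5} [P_k] ∈ relations`. -/
theorem soloInformed_t22_moveB :
    of soloInformedT22GRep - (of soloInformedT22P0 + of soloInformedT22P1 + of soloInformedT22P2
      + of soloInformedT22P3 + of soloInformedT22P4) ∈ relations := by
  have h := of_sub_sum_of_mem_relations_of_subset (Finset.univ : Finset (Fin 5)) soloInformedT22GRep
    soloInformedT22Pieces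
    (fun j _ => by fin_cases j <;> [exact soloInformed_ch4_subset_T22G.1;
      exact soloInformed_ch4_subset_T22G.2.1; exact soloInformed_ch4_subset_T22G.2.2.1;
      exact soloInformed_ch4_subset_T22G.2.2.2.1; exact soloInformed_ch4_subset_T22G.2.2.2.2])
    (fun j _ => by fin_cases j <;> exact fun _ _ => rfl) soloInformed_t22Wall_null
    (fun j _ j' _ hjj' => by
      fin_cases j <;> fin_cases j'
      · exact (hjj' rfl).elim
      · exact disjoint_left.2 fun t (ht : t ∈ soloInformedCh4 0 1 2 3) (ht' : t ∈ soloInformedCh4 0 2 1 3) => by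
          obtain ⟨-, h1, h2, h3⟩ := soloInformed_mem_ch4.1 ht
          obtain ⟨-, h1', h2', h3'⟩ := soloInformed_mem_ch4.1 ht'
          linarith
      · exact disjoint_left.2 fun t (ht : t ∈ soloInformedCh4 0 1 2 3) (ht' : t ∈ soloInformedCh4 0 2 3 1) => by
          obtain ⟨-, h1, h2, h3⟩ := soloInformed_mem_ch4.1 ht
          obtain ⟨-, h1', h2', h3'⟩ := soloInformed_mem_ch4.1 ht'
          linarith
      · exact disjoint_left.2 fun t (ht : t ∈ soloInformedCh4 0 1 2 3) (ht' : t ∈ soloInformedCh4 2 0 1 3) => by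
          obtain ⟨-, h1, h2, h3⟩ := soloInformed_mem_ch4.1 ht
          obtain ⟨-, h1', h2', h3'⟩ := soloInformed_mem_ch4.1 ht'
          linarith
      · exact disjoint_left.2 fun t (ht : t ∈ soloInformedCh4 0 1 2 3) (ht' : t ∈ soloInformedCh4 2 0 3 1) => by
          obtain ⟨-, h1, h2, h3⟩ := soloInformed_mem_ch4.1 ht
          obtain ⟨-, h1', h2', h3'⟩ := soloInformed_mem_ch4.1 ht'
          linarith
      · exact disjoint_left.2 fun t (ht : t ∈ soloInformedCh4 0 2 1 3) (ht' : t ∈ soloInformedCh4 0 1 2 3) => by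
          obtain ⟨-, h1, h2, h3⟩ := soloInformed_mem_ch4.1 ht
          obtain ⟨-, h1', h2', h3'⟩ := soloInformed_mem_ch4.1 ht'
          linarith
      · exact (hjj' rfl).elim
      · exact disjoint_left.2 fun t (ht : t ∈ soloInformedCh4 0 2 1 3) (ht' : t ∈ soloInformedCh4 0 2 3 1) => by
          obtain ⟨-, h1, h2, h3⟩ := soloInformed_mem_ch4.1 ht
          obtain ⟨-, h1', h2', h3'⟩ := soloInformed_mem_ch4.1 ht'
          linarith
      · exact disjoint_left.2 fun t (ht : t ∈ soloInformedCh4 0 2 1 3) (ht' : t ∈ soloInformedCh4 2 0 1 3) => by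
          obtain ⟨-, h1, h2, h3⟩ := soloInformed_mem_ch4.1 ht
          obtain ⟨-, h1', h2', h3'⟩ := soloInformed_mem_ch4.1 ht'
          linarith
      · exact disjoint_left.2 fun t (ht : t ∈ soloInformedCh4 0 2 1 3) (ht' : t ∈ soloInformedCh4 2 0 3 1) => by
          obtain ⟨-, h1, h2, h3⟩ := soloInformed_mem_ch4.1 ht
          obtain ⟨-, h1', h2', h3'⟩ := soloInformed_mem_ch4.1 ht'
          linarith
      · exact disjoint_left.2 fun t (ht : t ∈ soloInformedCh4 0 2 3 1) (ht' : t ∈ soloInformedCh4 0 1 2 3) => by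
          obtain ⟨-, h1, h2, h3⟩ := soloInformed_mem_ch4.1 ht
          obtain ⟨-, h1', h2', h3'⟩ := soloInformed_mem_ch4.1 ht'
          linarith
      · exact disjoint_left.2 fun t (ht : t ∈ soloInformedCh4 0 2 3 1) (ht' : t ∈ soloInformedCh4 0 2 1 3) => by
          obtain ⟨-, h1, h2, h3⟩ := soloInformed_mem_ch4.1 ht
          obtain ⟨-, h1', h2', h3'⟩ := soloInformed_mem_ch4.1 ht'
          linarith
      · exact (hjj' rfl).elim
      · exact disjoint_left.2 fun t (ht : t ∈ soloInformedCh4 0 2 3 1) (ht' : t ∈ soloInformedCh4 2 0 1 3) => by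
          obtain ⟨-, h1, h2, h3⟩ := soloInformed_mem_ch4.1 ht
          obtain ⟨-, h1', h2', h3'⟩ := soloInformed_mem_ch4.1 ht'
          linarith
      · exact disjoint_left.2 fun t (ht : t ∈ soloInformedCh4 0 2 3 1) (ht' : t ∈ soloInformedCh4 2 0 3 1) => by
          obtain ⟨-, h1, h2, h3⟩ := soloInformed_mem_ch4.1 ht
          obtain ⟨-, h1', h2', h3'⟩ := soloInformed_mem_ch4.1 ht'
          linarith
      · exact disjoint_left.2 fun t (ht : t ∈ soloInformedCh4 2 0 1 3) (ht' : t ∈ soloInformedCh4 0 1 2 3) => by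
          obtain ⟨-, h1, h2, h3⟩ := soloInformed_mem_ch4.1 ht
          obtain ⟨-, h1', h2', h3'⟩ := soloInformed_mem_ch4.1 ht'
          linarith
      · exact disjoint_left.2 fun t (ht : t ∈ soloInformedCh4 2 0 1 3) (ht' : t ∈ soloInformedCh4 0 2 1 3) => by
          obtain ⟨-, h1, h2, h3⟩ := soloInformed_mem_ch4.1 ht
          obtain ⟨-, h1', h2', h3'⟩ := soloInformed_mem_ch4.1 ht'
          linarith
      · exact disjoint_left.2 fun t (ht : t ∈ soloInformedCh4 2 0 1 3) (ht' : t ∈ soloInformedCh4 0 2 3 1) => by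
          obtain ⟨-, h1, h2, h3⟩ := soloInformed_mem_ch4.1 ht
          obtain ⟨-, h1', h2', h3'⟩ := soloInformed_mem_ch4.1 ht'
          linarith
      · exact (hjj' rfl).elim
      · exact disjoint_left.2 fun t (ht : t ∈ soloInformedCh4 2 0 1 3) (ht' : t ∈ soloInformedCh4 2 0 3 1) => by
          obtain ⟨-, h1, h2, h3⟩ := soloInformed_mem_ch4.1 ht
          obtain ⟨-, h1', h2', h3'⟩ := soloInformed_mem_ch4.1 ht'
          linarith
      · exact disjoint_left.2 fun t (ht : t ∈ soloInformedCh4 2 0 3 1) (ht' : t ∈ soloInformedCh4 0 1 2 3) => by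
          obtain ⟨-, h1, h2, h3⟩ := soloInformed_mem_ch4.1 ht
          obtain ⟨-, h1', h2', h3'⟩ := soloInformed_mem_ch4.1 ht'
          linarith
      · exact disjoint_left.2 fun t (ht : t ∈ soloInformedCh4 2 0 3 1) (ht' : t ∈ soloInformedCh4 0 2 1 3) => by
          obtain ⟨-, h1, h2, h3⟩ := soloInformed_mem_ch4.1 ht
          obtain ⟨-, h1', h2', h3'⟩ := soloInformed_mem_ch4.1 ht'
          linarith
      · exact disjoint_left.2 fun t (ht : t ∈ soloInformedCh4 2 0 3 1) (ht' : t ∈ soloInformedCh4 0 2 3 1) => by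
          obtain ⟨-, h1, h2, h3⟩ := soloInformed_mem_ch4.1 ht
          obtain ⟨-, h1', h2', h3'⟩ := soloInformed_mem_ch4.1 ht'
          linarith
      · exact disjoint_left.2 fun t (ht : t ∈ soloInformedCh4 2 0 3 1) (ht' : t ∈ soloInformedCh4 2 0 1 3) => by
          obtain ⟨-, h1, h2, h3⟩ := soloInformed_mem_ch4.1 ht
          obtain ⟨-, h1', h2', h3'⟩ := soloInformed_mem_ch4.1 ht'
          linarith
      · exact (hjj' rfl).elim)
  simpa [soloInformedT22Pieces, Fin.sum_univ_five, add_assoc] using h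

/-- Unfolding lemmas. -/
@[simp] theorem soloInformedT22P0_domain : soloInformedT22P0.domain = soloInformedCh4 0 1 2 3 := rfl
/-- Auxiliary. -/
@[simp] theorem soloInformedT22P1_domain : soloInformedT22P1.domain = soloInformedCh4 0 2 1 3 := rfl
/-- Auxiliary. -/
@[simp] theorem soloInformedT22P2_domain : soloInformedT22P2.domain = soloInformedCh4 0 2 3 1 := rfl
/-- Auxiliary. -/
@[simp] theorem soloInformedT22P3_domain : soloInformedT22P3.domain = soloInformedCh4 2 0 1 3 := rfl
/-- Auxiliary. -/
@[simp] theorem soloInformedT22P4_domain : soloInformedT22P4.domain = soloInformedCh4 2 0 3 1 := rfl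
/-- Auxiliary. -/
@[simp] theorem soloInformedT22P0_integrand : soloInformedT22P0.integrand = soloInformedT22g := rfl
/-- Auxiliary. -/
@[simp] theorem soloInformedT22P1_integrand : soloInformedT22P1.integrand = soloInformedT22g := rfl
/-- Auxiliary. -/
@[simp] theorem soloInformedT22P2_integrand : soloInformedT22P2.integrand = soloInformedT22g := rfl
/-- Auxiliary. -/
@[simp] theorem soloInformedT22P3_integrand : soloInformedT22P3.integrand = soloInformedT22g := rfl
/-- Auxiliary. -/
@[simp] theorem soloInformedT22P4_integrand : soloInformedT22P4.integrand = soloInformedT22g := rfl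

end Summit.KontsevichZagierPeriods.KontsevichZagierPeriods.Theorems
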